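import Literature.NumberTheory.Transcendental.TijdemanZeroEstimateProofs
import HarnessLib

/-!
# Exponential polynomials with distinct frequencies do not vanish identically

Topic `Literature/NumberTheory/Transcendental`. The functions `z^k e^{σ_l z}` (`k ≥ 0`, `σ_l`
pairwise distinct complex numbers) are linearly independent over `ℂ`: an exponential polynomial
`F(z) = ∑_l Q_l(z) e^{σ_l z}` with polynomial coefficients `Q_l` and distinct frequencies that
vanishes identically has all `Q_l = 0`. This is the (tacit) first step of every zero estimate for
exponential polynomials — Tijdeman's lemma in Baker's form (`Baker1975_tijdemanLemma`,
`TijdemanZeroEstimate.lean`; proved in `TijdemanZeroEstimateProofs.lean`) bounds the zeros of `F`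
"for which `F` does not vanish identically" (Baker 1975, Ch. 12 §2, p. 112), and in the
applications (Gel'fond 1949, Tijdeman 1971; Baker 1975, Ch. 12 §5) `F ≢ 0` is obtained from
"the coefficients are not all zero and the frequencies are distinct".

Proof (the classical one, by the operators `D - a` of `TijdemanZeroEstimateProofs.lean`,
`Tijdeman.pstep`): if `∑_l Q_l e^{σ_l z} ≡ 0` and `Q_{l₀} ≠ 0`, apply `D - σ_{l₀}`: the new
coefficients are `Q_l' + (σ_l - σ_{l₀}) Q_l`, of the same degree for `l ≠ l₀` and of smaller
degree (namely `Q_{l₀}'`) at `l₀`; by induction on `∑_l (deg Q_l + 1)` all the new coefficients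
vanish, which forces `Q_l = 0` for `l ≠ l₀` (compare degrees, `σ_l ≠ σ_{l₀}`) and `Q_{l₀}`
constant, and then `Q_{l₀} e^{σ_{l₀} z} ≡ 0` gives `Q_{l₀} = 0`.

## Contents (no definitions)

* `Tijdeman.qexp_pstep_eq_zero` — `qexp Q σ = 0 → qexp (pstep σ a Q) σ = 0`;
* `Tijdeman.eq_zero_of_qexp_eq_zero` — `σ` injective, `qexp Q σ = 0` ⟹ `Q = 0`;
* `expPolynomial_ne_zero` — `σ` injective, `f ≠ 0` ⟹ `expPolynomial f σ ≠ 0`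
  (the hypothesis of `card_zeroMultiset_expPolynomial_le`).

## References

* [BakerTNT1975] A. Baker, *Transcendental Number Theory*, CUP 1975, Ch. 12 §2, p. 112
  ("the f's are arbitrary complex numbers for which `F` does not vanish identically").
-/

noncomputable section

open Complex Polynomial Finset

namespace Literature.NumberTheory.Transcendental

namespace Tijdeman

variable {L : ℕ}

/-- Applying `D - a` to an identically vanishing exponential polynomial gives one:
`qexp Q σ = 0 → qexp (pstep σ a Q) σ = 0`. [folklore] -/
theorem qexp_pstep_eq_zero {Q : Fin L → ℂ[X]} {σ : Fin L → ℂ} (h : qexp Q σ = 0) (a : ℂ) :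
    qexp (pstep σ a Q) σ = 0 := by
  funext z
  rw [← deriv_qexp_sub Q σ a z, h]
  simp

/-- The size `∑_l (deg Q_l + 1)` (zero polynomials not counted) used for the induction
vanishes iff `Q = 0`. [folklore] -/
lemma qsize_eq_zero_iff (Q : Fin L → ℂ[X]) :
    (∑ l, if Q l = 0 then 0 else (Q l).natDegree + 1) = 0 ↔ Q = 0 := by
  rw [Finset.sum_eq_zero_iff]
  constructor
  · intro h
    funext l
    show Q l = 0
    have := h l (Finset.mem_univ l)
    by_contra hl
    rw [if_neg hl] at this
    omega
  · rintro rfl l -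
    simp

/-- The coefficient at `l₀` after `D - σ_{l₀}` is the derivative `Q_{l₀}'`. [folklore] -/
lemma pstep_self (σ : Fin L → ℂ) (Q : Fin L → ℂ[X]) (l₀ : Fin L) :
    pstep σ (σ l₀) Q l₀ = derivative (Q l₀) := by
  simp [pstep]

/-- The coefficients after `D - a` have degree at most the old ones. [folklore] -/
lemma natDegree_pstep_le (σ : Fin L → ℂ) (a : ℂ) (Q : Fin L → ℂ[X]) (l : Fin L) :
    (pstep σ a Q l).natDegree ≤ (Q l).natDegree := by
  unfold pstep
  refine (natDegree_add_le _ _).trans (max_le ?_ ?_)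
  · exact (natDegree_derivative_le _).trans (Nat.sub_le _ _)
  · exact natDegree_C_mul_le _ _

/-- If `Q_l' + c Q_l = 0` with `c ≠ 0` then `Q_l = 0` (compare degrees). [folklore] -/
lemma eq_zero_of_derivative_add_C_mul_eq_zero {q : ℂ[X]} {c : ℂ} (hc : c ≠ 0)
    (h : derivative q + C c * q = 0) : q = 0 := by
  by_contra hq
  have hCq : (C c * q).natDegree = q.natDegree := natDegree_C_mul hc
  have hneg : C c * q = -derivative q := eq_neg_of_add_eq_zero_right h
  rcases Nat.eq_zero_or_pos q.natDegree with h0 | hpos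
  · have hd : derivative q = 0 := derivative_of_natDegree_zero h0
    rw [hd, neg_zero, mul_eq_zero] at hneg
    rcases hneg with h1 | h1
    · exact hc (C_eq_zero.mp h1)
    · exact hq h1
  · have hlt : (derivative q).natDegree < q.natDegree := natDegree_derivative_lt hpos.ne'
    have := congrArg natDegree hneg
    rw [hCq, natDegree_neg] at this
    omega

/-- **Linear independence of `z^k e^{σ_l z}`**: if the frequencies `σ_l` are pairwise distinct
and `∑_l Q_l(z) e^{σ_l z} = 0` for all `z`, then every `Q_l = 0`. [folklore] -/
theorem eq_zero_of_qexp_eq_zero {σ : Fin L → ℂ} (hσ : Function.Injective σ) :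
    ∀ (N : ℕ) (Q : Fin L → ℂ[X]), (∑ l, if Q l = 0 then 0 else (Q l).natDegree + 1) ≤ N →
      qexp Q σ = 0 → Q = 0 := by
  intro N
  induction N with
  | zero =>
    intro Q hN _
    exact (qsize_eq_zero_iff Q).mp (Nat.le_zero.mp hN)
  | succ N ih =>
    intro Q hN hQ
    by_contra hQ0
    obtain ⟨l₀, hl₀⟩ := Function.ne_iff.mp hQ0
    replace hl₀ : Q l₀ ≠ 0 := hl₀
    set Q' : Fin L → ℂ[X] := pstep σ (σ l₀) Q with hQ'
    have hQ'exp : qexp Q' σ = 0 := qexp_pstep_eq_zero hQ (σ l₀)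
    -- the size drops
    have hsize : (∑ l, if Q' l = 0 then 0 else (Q' l).natDegree + 1) <
        ∑ l, if Q l = 0 then 0 else (Q l).natDegree + 1 := by
      refine Finset.sum_lt_sum (fun l _ => ?_) ⟨l₀, Finset.mem_univ _, ?_⟩
      · by_cases hl : Q l = 0
        · have : Q' l = 0 := by simp [hQ', pstep, hl]
          rw [if_pos hl, if_pos this]
        · rw [if_neg hl]
          split_ifs
          · exact Nat.zero_le _
          · exact Nat.succ_le_succ (natDegree_pstep_le σ _ Q l)
      · rw [if_neg hl₀, hQ', pstep_self]
        split_ifs with hd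
        · exact Nat.succ_pos _
        · refine Nat.succ_lt_succ (natDegree_derivative_lt fun h0 => hd ?_)
          exact derivative_of_natDegree_zero h0
    have hQ'0 : Q' = 0 := ih Q' (by omega) hQ'exp
    -- consequences: `Q_l = 0` for `l ≠ l₀`, `Q_{l₀}` constant
    have hother : ∀ l, l ≠ l₀ → Q l = 0 := by
      intro l hl
      have h := congr_fun hQ'0 l
      simp only [hQ', pstep, Pi.zero_apply] at h
      exact eq_zero_of_derivative_add_C_mul_eq_zero (sub_ne_zero.mpr fun e => hl (hσ e)) h
    have hder : derivative (Q l₀) = 0 := by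
      have h := congr_fun hQ'0 l₀
      rwa [hQ', pstep_self] at h
    have hconst : Q l₀ = C ((Q l₀).coeff 0) :=
      eq_C_of_natDegree_eq_zero (Polynomial.derivative_eq_zero.mp hder)
    -- evaluate the vanishing sum at `z = 0`
    have h0 := congr_fun hQ 0
    simp only [qexp, mul_zero, Complex.exp_zero, mul_one, Pi.zero_apply] at h0
    rw [Finset.sum_eq_single l₀ (fun l _ hl => by rw [hother l hl, eval_zero])
      (fun h => absurd (Finset.mem_univ _) h)] at h0
    apply hl₀
    rw [hconst] at h0 ⊢
    rw [eval_C] at h0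
    rw [h0, C_0]

/-- Functional form: `σ` injective and `qexp Q σ = 0` imply `Q = 0`. [folklore] -/
theorem qexp_eq_zero_iff {σ : Fin L → ℂ} (hσ : Function.Injective σ) (Q : Fin L → ℂ[X]) :
    qexp Q σ = 0 ↔ Q = 0 :=
  ⟨fun h => eq_zero_of_qexp_eq_zero hσ _ Q le_rfl h, fun h => by rw [h, qexp_zero]⟩

/-- The coefficient polynomials of `expPolynomial f σ` vanish only if `f = 0`. [folklore] -/
lemma coeffPoly_eq_zero_iff {K : ℕ} (f : Fin K → Fin L → ℂ) : coeffPoly f = 0 ↔ f = 0 := by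
  constructor
  · intro h
    funext k l
    have hl := congr_fun h l
    have hk := congrArg (fun q : ℂ[X] => q.coeff k) hl
    simp only [coeffPoly, Pi.zero_apply, coeff_zero, finsetSum_coeff, coeff_C_mul_X_pow] at hk
    rw [Finset.sum_eq_single k (fun k' _ hk' => if_neg (fun e => hk' (Fin.ext e).symm))
      (fun h => absurd (Finset.mem_univ _) h), if_pos rfl] at hk
    exact hk
  · rintro rfl
    funext l
    simp [coeffPoly]

end Tijdeman

open Tijdeman in
/-- **An exponential polynomial with distinct frequencies and coefficients not all zero does not
vanish identically** (the hypothesis "`F` does not vanish identically" of Tijdeman's lemma,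
Baker 1975, Ch. 12 §2, Lemma 1, from "not all `f(k,l)` are `0`"). [folklore] -/
theorem expPolynomial_ne_zero {K L : ℕ} {f : Fin K → Fin L → ℂ} {σ : Fin L → ℂ}
    (hσ : Function.Injective σ) (hf : f ≠ 0) : expPolynomial f σ ≠ 0 := by
  intro h
  rw [expPolynomial_eq_qexp, qexp_eq_zero_iff hσ, coeffPoly_eq_zero_iff] at h
  exact hf h

end Literature.NumberTheory.Transcendental

end
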